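import Summits.QuantumFields.BalabanUV.T4Continuum.Support.NE3QuadRemainderSup
import Summits.QuantumFields.BalabanUV.T4Continuum.Support.NE7DirIterL1Letter
import HarnessLib

/-!
# NE7QuadRemL1Reduction — THE k-FOLD QUADRATIC REMAINDER IN `ℓ¹`, REDUCED TO THE LEVEL-WISE ONE-STEP REMAINDERS WITH A k-FREE CONSTANT
# (memo ROAD-G102 §9 STEP 2, §10.3)

Cell `pub-balaban`, lineage `t4-ne7-p1` (CRUX PROVER NE7 #1, owner of BINDER row NE7), gen 102.  The `ℓ¹` twin of row NE3's sup letter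
`NE3QuadRemainderSup.norm_relIter_sub_dirIter_le` (same induction over the telescope `NE3QuadRemainderTower.dirIter_push_telescope`, same level packages
`NE3QuadRemainderLevels.levelPkg` ∕ `level_remainder`), with the sup letter of the pushes replaced by gen 95's k-FREE `ℓ¹` letter of the linearised k-fold average
`NE7DirIterL1Letter.dirL1_dirIter_le` (the straight part contracts by `(L∕L^d)` per level, the frame part is carried with an `O(1)` weight):
  `dirL1 ([relIter − dirIter] L K W X) (periodBox N) ≤ C₁(d,L,K) · Σ_{i<K} dirL1 (E_i) (periodBox (L^{K−1−i}·N))`,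
`E_i := relStep(cavgIter i W)(relIter i W X) − cpush(cavgIter i W)(relIter i W X)` the one-step remainder at level `i` (a skew periodic field on lattice `i+1`), and
`C₁(d,L,K) = 3 + 2d·(dL(2nbRad+1)^d·3·Σ_{m<K}(L∕L^d)^m) ≤ 3 + 6d²L(2nbRad+1)^d∕(1 − L^{1−d})` (written out; no new definition) — NO factor `L^K`: in `ℓ¹` the k-fold quadratic remainder costs no more than the
SUM of the level-wise one-step remainders in `ℓ¹`.  With `NE7SliceCoarseDatumStraight.coarseDatum_eq_neg_quadRem_sub` this reduces the direct letter (DL1) of hDL′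
(`NE7HintOfDirectLettersSU2FM`) to `Σ_i dirL1(E_i(R′)) ≤ q₁·E_w²` for the straight gauge copy `R′` of the representative (memo §10.3: the level-wise remainders in
ends∕corner form and the corner-charge-versus-energy input).
-/

set_option autoImplicit false

open scoped BigOperators Matrix.Norms.L2Operator
open NormedSpace Finset

namespace Summit.QuantumFields.BalabanUV.T4Continuum.NE7QuadRemL1Reduction

open Literature.MathematicalPhysics.QuantumFieldTheory.Balaban1983to89
open B7Prop1Explicit B7Prop2Explicit
open T4AveragingDeficitWall (IsSkewDir IsUnitaryCfg SmallField dirL1)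
open T4AveragingDeficitWallBoundary (IsPeriodicCfg periodBox)
open AveragingDeficitPeriodicCounting (IsPeriodicDir)
open AveragingDeficitChartCalculus (cavg)
open AveragingDeficitMultiLevelPrep (cpush cavgIter radIter tower LevelSmall)
open AveragingDeficitDerivCore (dirL1_nonneg)
open BlockAverageVaryHolo (nbRad)
open BlockAverageVaryDisc (rho0)
open NE3TangentCovariantTower (dirIter dirIter_zero)
open NE3LinearisedAverageSup (curvSum curvSum_mono)
open NE3QuadRemainderTower (relStep relIter relIter_zero dirIter_push_telescope relIter_skew)
open NE3QuadRemainderLevels (levelPkg level_remainder curvSum_shift_le)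
open NE3QuadRemainderSup (norm_relIter_le sigma_lines)
open NE3FramePotBoundW (tower_eq_pow_mul)
open NE7DirIterL1Letter (dirL1_dirIter_le)

noncomputable section

variable {d : ℕ} {n : Type*} [Fintype n] [DecidableEq n] [Nonempty n]

omit [Fintype n] [DecidableEq n] [Nonempty n] in
/-- The `(m+1)`-level constant of `dirL1_dirIter_le` is below the `K`-level constant `C₁(d,L,K) := 3 + 2d·(dL(2nbRad+1)^d·3·Σ_{m<K}(L∕L^d)^m)` for
`m + 1 ≤ K` (`d, L ≥ 1`). [folklore] -/
theorem pushConst_le_l1PushC {L K m : ℕ} (hd : 1 ≤ d) (hL : 1 ≤ L) (hm : m + 1 ≤ K) :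
    3 * ((L : ℝ) / (L : ℝ) ^ d) ^ (m + 1)
        + 2 * d * (((d : ℝ) * L) * (2 * nbRad d L + 1) ^ d * (3 * ∑ i ∈ range (m + 1), ((L : ℝ) / (L : ℝ) ^ d) ^ i))
      ≤ (3 + 2 * (d : ℝ) * (((d : ℝ) * L) * (2 * nbRad d L + 1) ^ d * (3 * ∑ m ∈ range K, ((L : ℝ) / (L : ℝ) ^ d) ^ m))) := by
  have hL1 : (1 : ℝ) ≤ L := by exact_mod_cast hL
  have hq1 : (L : ℝ) / (L : ℝ) ^ d ≤ 1 := by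
    rw [div_le_one (by positivity)]
    calc (L : ℝ) = (L : ℝ) ^ 1 := (pow_one _).symm
      _ ≤ (L : ℝ) ^ d := pow_le_pow_right₀ hL1 hd
  have hq0 : 0 ≤ (L : ℝ) / (L : ℝ) ^ d := by positivity
  have hpow : ((L : ℝ) / (L : ℝ) ^ d) ^ (m + 1) ≤ 1 := pow_le_one₀ hq0 hq1
  have hsum : ∑ i ∈ range (m + 1), ((L : ℝ) / (L : ℝ) ^ d) ^ i ≤ ∑ i ∈ range K, ((L : ℝ) / (L : ℝ) ^ d) ^ i :=
    Finset.sum_le_sum_of_subset_of_nonneg (Finset.range_mono hm) fun i _ _ => by positivity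
  have hc0 : 0 ≤ 2 * (d : ℝ) * (((d : ℝ) * L) * (2 * nbRad d L + 1) ^ d * 3) := by positivity
  nlinarith [mul_le_mul_of_nonneg_left hsum hc0]

/-- **THE k-FOLD QUADRATIC REMAINDER IN `ℓ¹` IS BELOW THE SUM OF THE LEVEL-WISE ONE-STEP REMAINDERS IN `ℓ¹`, k-FREE.**  For `d ≥ 1`, `2 ≤ L`, `1 ≤ N`, a unitary
`(L^K·N)`-periodic `W` in the tower class (`0 ≤ x`, `LevelSmall d L K x`, `SmallField W x`, `curvSum d L K x ≤ 2L∕3` and the `ℓ¹` curvature line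
`(L^d∕L·d(2nbRad+1)^d)·curvSum d L K x ≤ 2∕3`), a skew `(L^K·N)`-periodic `X` of sup `s` on the σ-line `4(3+12d)²L^K s ≤ ρ₀²`:
`dirL1 ([relIter − dirIter] L K W X) (periodBox N) ≤ C₁(d,L,K) · Σ_{i<K} dirL1 (E_i) (periodBox (L^{K−1−i}·N))`,
`E_i = relStep (cavgIter L i W) (relIter L i W X) − cpush (cavgIter L i W) (relIter L i W X)`. [folklore] -/
theorem dirL1_relIter_sub_dirIter_le {L N K : ℕ} [NeZero N] (hd : 1 ≤ d) (hL : 2 ≤ L) (hN : 1 ≤ N) {W : Site d → Fin d → (Matrix n n ℂ)ˣ} {x : ℝ}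
    (hWu : IsUnitaryCfg W) (hWP : IsPeriodicCfg W ((L ^ K * N : ℕ) : ℤ)) (hx : 0 ≤ x) (hsm : LevelSmall d L K x) (hWx : SmallField W x)
    (hA : curvSum d L K x ≤ 2 / 3 * L) (hA1 : ((L : ℝ) ^ d / L * (d * (2 * nbRad d L + 1) ^ d)) * curvSum d L K x ≤ 2 / 3)
    {X : Site d → Fin d → Matrix n n ℂ} (hXs : IsSkewDir X) (hXP : IsPeriodicDir X ((L ^ K * N : ℕ) : ℤ))
    {s : ℝ} (hs : 0 ≤ s) (hX : ∀ (z : Site d) (μ : Fin d), ‖X z μ‖ ≤ s)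
    (hσ : 4 * (3 + 12 * (d : ℝ)) ^ 2 * (L : ℝ) ^ K * s ≤ rho0 d L ^ 2) :
    dirL1 (fun z κ => relIter L K W X z κ - dirIter L K W X z κ) (periodBox (d := d) N)
      ≤ (3 + 2 * (d : ℝ) * (((d : ℝ) * L) * (2 * nbRad d L + 1) ^ d * (3 * ∑ m ∈ range K, ((L : ℝ) / (L : ℝ) ^ d) ^ m)))
        * ∑ i ∈ range K,
          dirL1 (fun z κ => relStep L (cavgIter L i W) (relIter L i W X) z κ - cpush L (cavgIter L i W) (relIter L i W X) z κ)
            (periodBox (d := d) (L ^ (K - 1 - i) * N)) := by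
  have hL1 : 1 ≤ L := by omega
  -- (1) the sup of the nonlinear coordinate at every level, the regime, skewness
  have hsup : ∀ i ≤ K, ∀ (z : Site d) (μ : Fin d), ‖relIter L i W X z μ‖ ≤ 2 * (3 + 12 * (d : ℝ)) * (L : ℝ) ^ i * s :=
    fun i hi z μ => norm_relIter_le hL hWu hWP hx hsm hWx hA hXs hXP hs hX hσ hi z μ
  have hreg : ∀ i < K, ∃ a t : ℝ, 0 ≤ a ∧ 512 * (d + 1) * (d + 4) * (L : ℝ) ^ 2 * a ≤ 1 ∧ IsUnitaryCfg (cavgIter L i W)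
      ∧ SmallField (cavgIter L i W) a ∧ 0 ≤ t ∧ (∀ (y : Site d) (κ : Fin d), ‖relIter L i W X y κ‖ ≤ t) ∧ t ≤ rho0 d L / 4 := by
    intro i hi
    obtain ⟨hU, hr, hS, -, h512, -, -⟩ := levelPkg hL1 hWu hWP hx hsm hWx hA (i := i) (by omega)
    exact ⟨_, _, hr, h512, hU, hS, by positivity, hsup i hi.le, (sigma_lines (d := d) hL hs hσ (i := i) hi.le).1⟩
  have hskew : ∀ i ≤ K, IsSkewDir (relIter L i W X) := fun i hi =>
    relIter_skew hL1 i hXs fun i' hi' => hreg i' (by omega)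
  -- (2) the one-step remainders: skew and periodic
  have hE : ∀ i < K,
      IsSkewDir (fun z κ => relStep L (cavgIter L i W) (relIter L i W X) z κ - cpush L (cavgIter L i W) (relIter L i W X) z κ)
      ∧ IsPeriodicDir (fun z κ => relStep L (cavgIter L i W) (relIter L i W X) z κ - cpush L (cavgIter L i W) (relIter L i W X) z κ)
          ((L ^ (K - i - 1) * N : ℕ) : ℤ) := by
    intro i hi
    obtain ⟨-, h2, h3, -⟩ := level_remainder hL1 hWu hWP hx hsm hWx hA hi hXP (hskew i hi.le) (t := 2 * (3 + 12 * (d : ℝ)) * (L : ℝ) ^ i * s)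
      (by positivity) (hsup i hi.le) (sigma_lines (d := d) hL hs hσ (i := i) hi.le).1
    exact ⟨h2, h3⟩
  -- (3) the target
  rcases K with _ | k'
  · simp only [Finset.range_zero, Finset.sum_empty, mul_zero]
    refine le_of_eq ?_
    unfold dirL1
    refine Finset.sum_eq_zero fun z _ => Finset.sum_eq_zero fun κ _ => ?_
    rw [relIter_zero, dirIter_zero]
    simp
  · -- abbreviation for the level terms
    have hQ : ∀ j : ℕ, j ≤ k' →
        dirL1 (fun z κ => dirIter L (k' - j) (cavgIter L (j + 1) W)
            (fun y μ => relIter L (j + 1) W X y μ - dirIter L (j + 1) W X y μ) z κ) (periodBox (d := d) N)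
          ≤ (3 + 2 * (d : ℝ) * (((d : ℝ) * L) * (2 * nbRad d L + 1) ^ d * (3 * ∑ m ∈ range (k' + 1), ((L : ℝ) / (L : ℝ) ^ d) ^ m)))
            * ∑ i ∈ range (j + 1),
              dirL1 (fun z κ => relStep L (cavgIter L i W) (relIter L i W X) z κ - cpush L (cavgIter L i W) (relIter L i W X) z κ)
                (periodBox (d := d) (L ^ (k' + 1 - 1 - i) * N)) := by
      -- the ℓ¹ letter of an `m`-fold push from level `i+1` (`i + 1 + m = k' + 1`)
      have hpush : ∀ (i m : ℕ), i + 1 + m = k' + 1 →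
          ∀ {E : Site d → Fin d → Matrix n n ℂ}, IsSkewDir E → IsPeriodicDir E ((L ^ (k' + 1 - i - 1) * N : ℕ) : ℤ) →
            dirL1 (dirIter L m (cavgIter L (i + 1) W) E) (periodBox (d := d) N)
              ≤ (3 + 2 * (d : ℝ) * (((d : ℝ) * L) * (2 * nbRad d L + 1) ^ d * (3 * ∑ m ∈ range (k' + 1), ((L : ℝ) / (L : ℝ) ^ d) ^ m)))
                * dirL1 E (periodBox (d := d) (L ^ (k' + 1 - 1 - i) * N)) := by
        intro i m him E hEs hEP
        have hKi : k' + 1 - i - 1 = m := by omega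
        have hKi' : k' + 1 - 1 - i = m := by omega
        rw [hKi] at hEP
        rw [hKi']
        rcases m with _ | m'
        · rw [dirIter_zero, pow_zero, one_mul]
          have h0 := dirL1_nonneg E (periodBox (d := d) N)
          have hC1 : (1 : ℝ) ≤ (3 + 2 * (d : ℝ) * (((d : ℝ) * L) * (2 * nbRad d L + 1) ^ d * (3 * ∑ m ∈ range (k' + 1), ((L : ℝ) / (L : ℝ) ^ d) ^ m))) := by
            have hsn : 0 ≤ ∑ m ∈ range (k' + 1), ((L : ℝ) / (L : ℝ) ^ d) ^ m := Finset.sum_nonneg fun _ _ => by positivity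
            have : 0 ≤ 2 * (d : ℝ) * (((d : ℝ) * L) * (2 * nbRad d L + 1) ^ d * (3 * ∑ m ∈ range (k' + 1), ((L : ℝ) / (L : ℝ) ^ d) ^ m)) := by positivity
            linarith
          nlinarith
        · obtain ⟨hU, hr, hS, hP, -, hls, -⟩ := levelPkg hL1 hWu hWP hx hsm hWx hA (i := i + 1) (by omega)
          have hP' : IsPeriodicCfg (cavgIter L (i + 1) W) ((tower L N (m' + 1) : ℕ) : ℤ) := by
            rw [tower_eq_pow_mul, show k' + 1 - (i + 1) = m' + 1 by omega] at *; exact hP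
          have hEP' : IsPeriodicDir E ((tower L N (m' + 1) : ℕ) : ℤ) := by rw [tower_eq_pow_mul]; exact hEP
          have hlsm : LevelSmall d L m' (radIter d L (i + 1) x) := by
            have := hls (m' + 1) (by omega) (by omega); simpa using this
          have hA1' : ((L : ℝ) ^ d / L * (d * (2 * nbRad d L + 1) ^ d)) * curvSum d L (m' + 1) (radIter d L (i + 1) x) ≤ 2 / 3 := by
            have hsh : curvSum d L (m' + 1) (radIter d L (i + 1) x) ≤ curvSum d L (k' + 1) x :=
              (curvSum_shift_le (d := d) L (i + 1) (m' + 1) hx).trans (curvSum_mono (d := d) L (show i + 1 + (m' + 1) ≤ k' + 1 by omega) hx)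
            have hc0 : 0 ≤ (L : ℝ) ^ d / L * (d * (2 * nbRad d L + 1) ^ d) := by positivity
            exact (mul_le_mul_of_nonneg_left hsh hc0).trans hA1
          have h := dirL1_dirIter_le hL1 hN m' hU hP' hr hlsm hS hEs hEP' hA1'
          rw [tower_eq_pow_mul] at h
          refine h.trans (mul_le_mul_of_nonneg_right (pushConst_le_l1PushC (d := d) hd hL1 (by omega)) (dirL1_nonneg _ _))
      intro j
      induction j with
      | zero =>
          intro _
          obtain ⟨h2, h3⟩ := hE 0 (by omega)
          have h := hpush 0 k' (by omega) h2 h3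
          rw [Nat.sub_zero, Finset.sum_range_one]
          exact (le_of_eq (by rfl)).trans h
      | succ j ihj =>
          intro hj
          obtain ⟨hU1, hr1, hS1, -, h5121, -, -⟩ := levelPkg hL1 hWu hWP hx hsm hWx hA (i := j + 1) (by omega)
          obtain ⟨hU2, hr2, hS2, -, -, hls2, -⟩ := levelPkg hL1 hWu hWP hx hsm hWx hA (i := j + 1 + 1) (by omega)
          have hsm2 : k' - (j + 1) = 0 ∨ LevelSmall d L (k' - (j + 1) - 1) (radIter d L (j + 1 + 1) x) := by
            rcases Nat.eq_zero_or_pos (k' - (j + 1)) with h0 | hpos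
            · exact Or.inl h0
            · exact Or.inr (hls2 (k' - (j + 1)) (by omega) hpos)
          have htel : (fun z κ => dirIter L (k' - (j + 1)) (cavgIter L (j + 1 + 1) W)
                (fun y μ => relIter L (j + 1 + 1) W X y μ - dirIter L (j + 1 + 1) W X y μ) z κ)
              = fun z κ => dirIter L (k' - (j + 1)) (cavgIter L (j + 1 + 1) W)
                    (fun y μ => relStep L (cavgIter L (j + 1) W) (relIter L (j + 1) W X) y μ
                      - cpush L (cavgIter L (j + 1) W) (relIter L (j + 1) W X) y μ) z κ
                  + dirIter L (k' - j) (cavgIter L (j + 1) W) (fun y μ => relIter L (j + 1) W X y μ - dirIter L (j + 1) W X y μ) z κ := by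
            funext z κ
            rw [dirIter_push_telescope hL1 (j + 1) (k' - (j + 1)) hU1 hr1 h5121 hS1 hU2 hr2 hsm2 hS2 X z κ,
              show k' - (j + 1) + 1 = k' - j by omega]
          rw [htel]
          -- `dirL1 (A + B) ≤ dirL1 A + dirL1 B` (pointwise form; the tree's `NE3.RemainderL1TowerB8.dirL1_add_le'`, inlined to keep the imports light)
          have hadd : ∀ (A B : Site d → Fin d → Matrix n n ℂ) (F : Finset (Site d)),
              dirL1 (fun z κ => A z κ + B z κ) F ≤ dirL1 A F + dirL1 B F := by
            intro A B F
            unfold dirL1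
            rw [← Finset.sum_add_distrib]
            refine Finset.sum_le_sum fun z _ => ?_
            rw [← Finset.sum_add_distrib]
            exact Finset.sum_le_sum fun κ _ => norm_add_le _ _
          refine (hadd _ _ _).trans ?_
          obtain ⟨h2, h3⟩ := hE (j + 1) (by omega)
          have hfirst := hpush (j + 1) (k' - (j + 1)) (by omega) h2 h3
          have hsecond := ihj (by omega)
          have hsr := Finset.sum_range_succ (fun i => dirL1 (fun z κ => relStep L (cavgIter L i W) (relIter L i W X) z κ
              - cpush L (cavgIter L i W) (relIter L i W X) z κ) (periodBox (d := d) (L ^ (k' + 1 - 1 - i) * N))) (j + 1)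
          rw [hsr, mul_add, add_comm ((3 + 2 * (d : ℝ) * (((d : ℝ) * L) * (2 * nbRad d L + 1) ^ d * (3 * ∑ m ∈ range (k' + 1), ((L : ℝ) / (L : ℝ) ^ d) ^ m))) * _)]
          exact add_le_add hfirst hsecond
    have h := hQ k' le_rfl
    rw [Nat.sub_self] at h
    simpa only [dirIter_zero] using h

end

end Summit.QuantumFields.BalabanUV.T4Continuum.NE7QuadRemL1Reduction
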